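import Mathlib
import Literature.NumberTheory.Transcendental.KZLogCalculusProofs
import Summits.KontsevichZagierPeriods.KontsevichZagierPeriods.Theses.InverseLandau
import Summits.KontsevichZagierPeriods.KontsevichZagierPeriods.Theorems.LogPrimitiveNL.Negative.Defs
import Summits.KontsevichZagierPeriods.KontsevichZagierPeriods.Theorems.LiouvilleUnfoldingLogPrimitiveNL

/-!
# `DlogLoopRelator` (stmt-KontsevichZagierPeriods-9135) — the specialised loop certificate

Support item of route `InverseLandau` (rank 9): for `φ` `ℚ`-semialgebraic, continuous and positive on
`[0,1]`, differentiable on `(0,1)` with derivative `φ'` there and `φ(0) = φ(1)`, the honest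
Kontsevich–Zagier representation `[(0,1), φ'/φ]` is a RELATION of the four-move calculus
(`KZ.of r ∈ KZ.relations`).

Proof (this file): it is the `0`-dimensional-base, one-monomial instance (`n = 0`, `k = 1`, `h = 1`,
`V = φ`, `V' = φ'`) of the logarithmic Newton–Leibniz rule `LogPrimitiveNL`, PROVED in the tree
(`Summit.KontsevichZagierPeriods.LiouvilleUnfolding.LogPrimitiveNL.LogPrimitiveNL_of`,
`Theorems/LiouvilleUnfoldingLogPrimitiveNL.lean`): the closed-fibre band `[[0,1], 𝟙_{(0,1)} · f]`
(`f = r.integrand`) and the base `[pt, log φ(1) − log φ(0)] = [pt, 0]` differ by a relation; the base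
is a relation (zero integrand), and closing the two endpoints of `(0,1)` costs nothing (rule 1a with
a null piece). No named fact is assumed.
-/

noncomputable section

open MeasureTheory Set
open Literature.NumberTheory.Transcendental
open Literature.ModelTheory.ExponentialFields (IsSemialgebraic isSemialgebraic_univ)
open Summit.KontsevichZagierPeriods.LiouvilleUnfolding.LogPrimitiveNL.Negative (snoc_fin_one_apply_zero)

namespace Summit.KontsevichZagierPeriods.InverseLandau

/-- **`DlogLoopRelator`** (stmt-KontsevichZagierPeriods-9135, support of route `InverseLandau`): for
`φ` `ℚ`-semialgebraic, continuous and positive on `[0,1]`, differentiable on `(0,1)` with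
`φ(0) = φ(1)`, every honest representation `r = [(0,1), φ'/φ]` lies in `KZ.relations`. It is the
`n = 0`, `k = 1` instance of the proved logarithmic Newton–Leibniz rule `LogPrimitiveNL_of`
(band `[0,1]` over the point, `h = 1`, `V = φ`): the base term is `log φ(1) − log φ(0) = 0`.
[cite: KontsevichZagier2001, §1.2] -/
theorem DlogLoopRelator_proof :
    Summit.KontsevichZagierPeriods.KontsevichZagierPeriods.Theses.InverseLandau.DlogLoopRelator := by
  intro phi dphi r hsa hcont hpos hder hloop hdom hint
  -- the base point `ℝ⁰` and the closed band `[0,1]`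
  have hτ : IsSemialgebraic ℚ (univ : Set (Fin 0 → ℝ)) := isSemialgebraic_univ
  have ha : IsSemialgebraicFunOn ℚ (univ : Set (Fin 0 → ℝ)) (fun _ => (0 : ℝ)) := by
    simpa using isSemialgebraicFunOn_ratCast hτ 0
  have hb : IsSemialgebraicFunOn ℚ (univ : Set (Fin 0 → ℝ)) (fun _ => (1 : ℝ)) := by
    simpa using isSemialgebraicFunOn_ratCast hτ 1
  set B : Set (Fin 1 → ℝ) := KZlog.band (univ : Set (Fin 0 → ℝ)) (fun _ => (0 : ℝ)) (fun _ => 1)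
    with hB_def
  have hB : B = {x : Fin 1 → ℝ | x 0 ∈ Icc (0 : ℝ) 1} := by
    ext z
    simp only [hB_def, KZlog.mem_band, mem_univ, true_and, mem_setOf_eq, mem_Icc, Fin.last_zero]
  have hBsa : IsSemialgebraic ℚ B := KZlog.isSemialgebraic_band ha hb
  have hmemB : ∀ z : Fin 1 → ℝ, z ∈ B ↔ z 0 ∈ Icc (0 : ℝ) 1 := fun z => by rw [hB]; rfl
  have hmemr : ∀ z : Fin 1 → ℝ, z ∈ r.domain ↔ z 0 ∈ Ioo (0 : ℝ) 1 := fun z => by rw [hdom]; rfl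
  have hr_sub : r.domain ⊆ B := fun z hz => (hmemB z).2 (Ioo_subset_Icc_self ((hmemr z).1 hz))
  have hrm : MeasurableSet r.domain := KZ.IntegralRep.measurableSet_domain_holds r
  -- the endpoints are null
  have hnull : volume (B \ r.domain) = 0 := by
    have hcov : B \ r.domain ⊆ {z : Fin 1 → ℝ | z (Fin.last 0) = 0} ∪ {z | z (Fin.last 0) = 1} := by
      intro z hz
      have h1 : z 0 ∈ Icc (0 : ℝ) 1 := (hmemB z).1 hz.1
      have h2 : ¬ z 0 ∈ Ioo (0 : ℝ) 1 := fun h => hz.2 ((hmemr z).2 h)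
      simp only [mem_union, mem_setOf_eq, Fin.last_zero]
      rcases h1.1.eq_or_lt with h0 | h0
      · exact Or.inl h0.symm
      · exact Or.inr (le_antisymm h1.2 (not_lt.1 fun hlt => h2 ⟨h0, hlt⟩))
    exact measure_mono_null hcov
      (measure_union_null (KZ.volume_setOf_last_eq_zero 0) (KZ.volume_setOf_last_eq_zero 1))
  have hEsa : IsSemialgebraic ℚ (B \ r.domain) := hBsa.diff r.isSemialgebraic_domain
  -- the closed-band representation `R = [B, 𝟙_{(0,1)} f]`
  set g : (Fin 1 → ℝ) → ℝ := r.domain.indicator r.integrand with hg_def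
  have hg_on : EqOn g r.integrand r.domain := fun z hz => indicator_of_mem hz _
  have hg_off : EqOn g (fun _ => (0 : ℝ)) (B \ r.domain) := fun z hz => indicator_of_notMem hz.2 _
  have hg_sa : IsSemialgebraicFunOn ℚ B g := by
    have h := IsSemialgebraicFunOn.union r.isSemialgebraicFunOn_integrand
      (by simpa using isSemialgebraicFunOn_ratCast hEsa 0) hg_on hg_off
    rwa [union_sdiff_cancel hr_sub] at h
  have hg_int : IntegrableOn g B :=
    ((integrable_indicator_iff hrm).2 r.integrableOn).integrableOn
  let R : KZ.IntegralRep 1 := ⟨B, g, hBsa, hg_sa, hg_int⟩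
  -- the base representation `[pt, 0]`
  let r' : KZ.IntegralRep 0 :=
    ⟨univ, fun _ => 0, hτ, by simpa using isSemialgebraicFunOn_ratCast hτ 0, integrableOn_zero⟩
  -- integrability of `φ'/φ` on the closed band
  have hint_open : IntegrableOn (fun z : Fin 1 → ℝ => dphi (z 0) / phi (z 0)) r.domain :=
    r.integrableOn.congr_fun hint hrm
  have hint_closed : IntegrableOn (fun z : Fin 1 → ℝ => (1 : ℝ) * dphi (z 0) / phi (z 0)) B := by
    have h1 : IntegrableOn (fun z : Fin 1 → ℝ => (1 : ℝ) * dphi (z 0) / phi (z 0)) r.domain := by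
      simpa only [one_mul] using hint_open
    have h2 : IntegrableOn (fun z : Fin 1 → ℝ => (1 : ℝ) * dphi (z 0) / phi (z 0)) (B \ r.domain) := by
      rw [IntegrableOn, Measure.restrict_eq_zero.2 hnull]
      exact integrable_zero_measure
    simpa only [union_sdiff_cancel hr_sub] using h1.union h2
  -- the proved logarithmic Newton–Leibniz rule, `n = 0`, `k = 1`, `h = 1`, `V = φ`
  have key : KZ.of R - KZ.of r' ∈ KZ.relations := by
    refine Summit.KontsevichZagierPeriods.LiouvilleUnfolding.LogPrimitiveNL.LogPrimitiveNL_of 0 1 R r'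
      (fun _ => (0 : ℝ)) (fun _ => 1) (fun _ _ => (1 : ℝ)) (fun _ z => phi (z 0))
      (fun _ z => dphi (z 0)) ha hb (fun _ _ => zero_le_one) rfl
      (fun _ => by simpa using isSemialgebraicFunOn_ratCast hτ 1) (fun _ => ?_) (fun _ z hz => ?_)
      (fun _ x _ => ?_) (fun _ x _ t ht => ?_) (fun _ => hint_closed) (fun x _ t ht => ?_)
      (fun x _ => ?_)
    · -- `V = φ` is semialgebraic on the closed band
      show IsSemialgebraicFunOn ℚ B (fun z : Fin 1 → ℝ => phi (z 0))
      rw [hB]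
      exact hsa
    · -- positivity
      exact hpos _ ((hmemB z).1 hz)
    · -- continuity on the closed fibre
      show ContinuousOn (fun t : ℝ => phi ((Fin.snoc x t : Fin 1 → ℝ) 0)) (Icc 0 1)
      simpa only [snoc_fin_one_apply_zero] using hcont
    · -- derivative on the open fibre
      show HasDerivAt (fun s : ℝ => phi ((Fin.snoc x s : Fin 1 → ℝ) 0))
        (dphi ((Fin.snoc x t : Fin 1 → ℝ) 0)) t
      simpa only [snoc_fin_one_apply_zero] using hder t ht
    · -- the band integrand on the open fibre is `φ'/φ`
      have hmem : (Fin.snoc x t : Fin 1 → ℝ) ∈ r.domain :=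
        (hmemr _).2 (by simpa only [snoc_fin_one_apply_zero] using ht)
      show g (Fin.snoc x t) = _
      rw [hg_on hmem, hint hmem]
      simp only [snoc_fin_one_apply_zero, Fin.sum_univ_one, one_mul]
    · -- the base integrand is `log φ(1) − log φ(0) = 0`
      show (0 : ℝ) = _
      simp only [snoc_fin_one_apply_zero, Fin.sum_univ_one, one_mul, hloop, sub_self]
  -- `[pt, 0]` is a relation
  have h0 : KZ.of r' ∈ KZ.relations := KZ.of_mem_relations_of_eqOn_zero r' fun _ _ => rfl
  -- closing the endpoints: `[B, g] = [r] + [B ∖ (0,1), g]`, the latter over a null domain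
  let r₂ : KZ.IntegralRep 1 := R.restrict (B \ r.domain) hEsa sdiff_subset
  have h1 : KZ.of R - KZ.of r - KZ.of r₂ ∈ KZ.relations :=
    KZ.domainAddRel_subset_relations ⟨1, R, r, r₂, (union_sdiff_cancel hr_sub).symm, by
      show volume (r.domain ∩ (B \ r.domain)) = 0
      rw [inter_sdiff_self, measure_empty], hg_on, fun _ _ => rfl, rfl⟩
  have h2 : KZ.of r₂ ∈ KZ.relations := KZ.of_mem_relations_of_volume_eq_zero r₂ hnull
  have hsum : KZ.of r = (KZ.of R - KZ.of r') + KZ.of r' - (KZ.of R - KZ.of r - KZ.of r₂) - KZ.of r₂ := by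
    abel
  rw [hsum]
  exact KZ.relations.sub_mem (KZ.relations.sub_mem (KZ.relations.add_mem key h0) h1) h2

end Summit.KontsevichZagierPeriods.InverseLandau

end
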